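import Mathlib.NumberTheory.Real.Irrational
import Literature.AlgebraicGeometry.Frobenioids.MotivatingExamplesSub
import Literature.AlgebraicGeometry.Frobenioids.GeometricFrobenioidStandard
import HarnessLib

/-!
# Frobenioids I, §6 sub-DAG, row T62ii/L03 `Thm62_geomHypotheses Γ`: the universal closure AS TYPED (no
# `K̃/K` Galois) is FALSE; the printed instance form (`K̃/K` Galois) is the landed `Thm62_geomHypotheses_holds`

Mochizuki, *The geometry of Frobenioids I: the general theory*, Kyushu J. Math. **62** (2008) 293–400,
Example 6.1, kurims text p. 109: "Let … `K̃` be a Galois extension of `K` … `G := Gal(K̃/K)` … `D := B(G)⁰` … the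
assignments `L ↦ Φ(L)`, `L ↦ B(L)` determine, respectively, a perf-factorial divisorial monoid `Φ` on `D` … a
group-like monoid `B` on `D`"; Theorem 6.2, p. 110 [cite: MochizukiFrdI2008, Ex. 6.1 p.109]
[cite: MochizukiFrdI2008, Thm. 6.2 p.110].

PROOF-ONLY companion (cell abc-iut, block F fact-proving wave, seat abc-iut-f-043; FACT-LIST row F-1133 of
`plan/FACT-LIST.md`, `kernel_closedness = parametrised`, label "conditional: `Thm62_geomHypotheses_holds` needs
the Prop instance `[IsGalois K Kt]`"). No definitions, nothing re-typed; the declaring file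
`MotivatingExamplesSub.lean` and the interface `GeometricDivisorData` (v4) are imported, never edited.

WHAT THE KERNEL RECORDS. The row's declaration `Thm62_geomHypotheses (Γ : GeometricDivisorData K Kt)` — "the
hypotheses of Thm. 5.2 for the data of Ex. 6.1", i.e. `ModelFrobenioid.Hypotheses (geomDivisorFunctor Γ)
(geomUnitsFunctor Γ)` — is typed over an ARBITRARY extension `Kt/K`, whereas the print's standing hypothesis is
"`K̃` a Galois extension of `K`". AS TYPED the universal closure is false (`not_forall_Thm62_geomHypotheses`):
over `K = ℚ ⊆ K̃ = ℝ` (not Galois) the arrow `Spec ℚ(∛2) → Spec ℚ` of `D = FinSubextCat ℚ ℝ` is an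
FSM-morphism that is not an isomorphism — a monomorphism because a `ℚ`-algebra map out of `ℚ(∛2)` into a
subfield of `ℝ` must send `∛2` to the unique real cube root of `2` (so any two parallel arrows into `Spec ℚ(∛2)`
coincide), fiberwise-surjective through composita — and "`Φ` is a monoid on `D`" (Def. 1.1 (ii): FSM-morphisms
pull back to bijections) then fails for the admissible interface datum `Γ` with one prime divisor everywhere,
unramified identity pull-backs, `B = 1`, and `Φ(L) = ℤ_{≥0}` except `Φ(L) = 2ℤ_{≥0}` over the degree-one `L`
(every axiom of `GeometricDivisorData` v4 holds: functoriality, `Φ` saturated and `ℚ`-Cartier, `div` natural):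
the divisor `1 ∈ Φ(ℚ(∛2))` is not pulled back from `Φ(ℚ) = 2ℤ_{≥0}`. Under the PRINTED hypothesis `K̃/K`
Galois every monomorphism of `D` is an isomorphism (`FinSubextCat.isIso_of_mono`) and the row holds for EVERY
`Γ`: `Thm62_geomHypotheses_holds` (abc-iut-L6-t10, `GeometricFrobenioidStandard.lean`, imported here so that the
pair is visible from one module; not restated). So F-1133 is: universal closure REFUTED; instance form (Galois, as
printed) PROVED — consumers keep `[IsGalois K Kt]`. Nothing here bears on [IUTchIII] Cor. 3.12 or asserts
anything about abc.
-/

namespace Literature.AlgebraicGeometry.Frobenioids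

open CategoryTheory IntermediateField Polynomial

/-- **F-1133, universal closure AS TYPED (no Galois hypothesis) is false.** Countermodel (built inside the
proof, no definitions): `K = ℚ`, `K̃ = ℝ`; `Γ` with `D_L = {pt}`, `Φ(L) = {D | [L : ℚ] ≤ 1 → D(pt) even}`,
`B(L) = 1`, identity `over`, ramification `1`; the FSM non-isomorphism `σ : Spec ℚ(∛2) → Spec ℚ`; the divisor
`1 ∈ Φ(ℚ(∛2))` has no `σ^*`-preimage in `Φ(ℚ) = 2ℤ_{≥0}`, contradicting Def. 1.1 (ii) (b) inside
`ModelFrobenioid.Hypotheses.isMonoidOn`. [cite: MochizukiFrdI2008, Ex. 6.1 p.109] -/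
theorem not_forall_Thm62_geomHypotheses :
    ¬ ∀ {K : Type} [Field K] {Kt : Type} [Field Kt] [Algebra K Kt] (Γ : GeometricDivisorData K Kt),
        Thm62_geomHypotheses Γ := by
  intro h
  -- the real cube root of 2: a real number, integral over ℚ, irrational
  obtain ⟨α, hα3⟩ : ∃ α : ℝ, α ^ 3 = 2 :=
    ⟨(2 : ℝ) ^ ((3 : ℕ) : ℝ)⁻¹, Real.rpow_inv_natCast_pow (by norm_num) (by norm_num)⟩
  have hαint : _root_.IsIntegral ℚ α :=
    ⟨X ^ 3 - C 2, monic_X_pow_sub_C _ (by norm_num), by simp [hα3]⟩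
  have hirr : Irrational α := by
    refine irrational_nrt_of_notint_nrt 3 2 (by exact_mod_cast hα3) ?_ (by norm_num)
    rintro ⟨y, hy⟩
    have h3 : y ^ 3 = 2 := by exact_mod_cast (show (y : ℝ) ^ 3 = 2 by rw [← hy]; exact hα3)
    have hdvd : y ∣ 2 := ⟨y ^ 2, by rw [← h3]; ring⟩
    have hle : y ≤ 2 := Int.le_of_dvd (by norm_num) hdvd
    have hge : -2 ≤ y := by
      have := Int.le_of_dvd (by norm_num) (Int.neg_dvd.mpr hdvd)
      omega
    interval_cases y <;> omega
  have hα_not_mem : α ∉ (⊥ : IntermediateField ℚ ℝ) := by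
    rw [IntermediateField.mem_bot]
    rintro ⟨q, hq⟩
    exact hirr ⟨q, ((eq_ratCast (algebraMap ℚ ℝ) q).symm.trans hq)⟩
  haveI : FiniteDimensional ℚ ℚ⟮α⟯ := adjoin.finiteDimensional hαint
  have hfin : ¬ Module.finrank ℚ ℚ⟮α⟯ ≤ 1 := by
    intro hle
    have h1 : Module.finrank ℚ ℚ⟮α⟯ = 1 := le_antisymm hle Module.finrank_pos
    exact hα_not_mem (adjoin_simple_eq_bot_iff.mp (finrank_eq_one_iff.mp h1))
  -- rigidity: a ℚ-algebra map out of ℚ(α) into a subfield of ℝ sends α to α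
  have hrig : ∀ (E : IntermediateField ℚ ℝ) (φ : ℚ⟮α⟯ →ₐ[ℚ] E),
      ((φ (AdjoinSimple.gen ℚ α) : E) : ℝ) = α := by
    intro E φ
    have hgen3 : AdjoinSimple.gen ℚ α ^ 3 = 2 := by
      apply Subtype.ext
      rw [SubmonoidClass.coe_pow, AdjoinSimple.coe_gen, hα3]
      norm_cast
    have h3 : (((φ (AdjoinSimple.gen ℚ α) : E) : ℝ)) ^ 3 = 2 := by
      have h := map_pow φ (AdjoinSimple.gen ℚ α) 3
      rw [hgen3, map_ofNat] at h
      rw [← SubmonoidClass.coe_pow, ← h]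
      rfl
    exact (Odd.strictMono_pow (⟨1, rfl⟩ : Odd 3)).injective (h3.trans hα3.symm)
  -- ℚ-algebra maps out of the bottom field `⊥ = ℚ` are unique
  have hbot : ∀ (E : IntermediateField ℚ ℝ) (φ ψ : (⊥ : IntermediateField ℚ ℝ) →ₐ[ℚ] E), φ = ψ := by
    intro E φ ψ
    apply AlgHom.ext
    intro z
    obtain ⟨q, hq⟩ := IntermediateField.mem_bot.mp z.2
    have hz : z = algebraMap ℚ (⊥ : IntermediateField ℚ ℝ) q := Subtype.ext (by simpa using hq.symm)
    rw [hz, AlgHom.commutes, AlgHom.commutes]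
  -- the interface datum Γ over ℝ/ℚ
  let Γ : GeometricDivisorData ℚ ℝ :=
    { primeDiv := fun _ => Unit
      Phi := fun L =>
        { carrier := {D | Module.finrank ℚ L.L ≤ 1 → Even (D ())}
          zero_mem' := fun _ => ⟨0, rfl⟩
          add_mem' := fun {D E} hD hE hL => by
            rw [Finsupp.add_apply]
            exact (hD hL).add (hE hL) }
      B := fun _ => ⊥
      div := fun _ => 1
      over := fun _ Q => Q
      ram := fun _ _ => 1
      ram_pos := fun _ _ => Nat.one_pos
      over_finite := fun _ _ => Set.toFinite _
      over_surjective := fun _ => Function.surjective_id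
      over_id := fun _ _ => rfl
      ram_id := fun _ _ => rfl
      over_comp := fun _ _ _ => rfl
      ram_comp := fun _ _ _ => rfl
      pull_mem := fun {L M} τ D hD hM => by
        rw [DivisorCoeff.pull_apply, Nat.cast_one, one_mul]
        exact hD ((LinearMap.finrank_le_finrank_of_injective (f := τ.toAlgHom.toLinearMap)
          (τ.toAlgHom : L.L →+* M.L).injective).trans hM)
      map_mem := fun τ f hf => by
        rw [Subgroup.mem_bot] at hf ⊢
        rw [hf, map_one]
      div_natural := fun τ f => by simp
      div_mem_gp := fun L f => ⟨0, zero_mem _, 0, zero_mem _, by simp⟩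
      qCartier := fun L P => ⟨2, two_pos, fun _ => by rw [Finsupp.single_eq_same]; exact ⟨1, rfl⟩⟩
      sub_mem := fun L D E hD hE hle hL => by
        rw [Finsupp.tsub_apply]
        exact (Nat.even_sub (hle ())).mpr (iff_of_true (hD hL) (hE hL))
      primeDiv_nonempty := ⟨⟨⊥⟩, ⟨()⟩⟩ }
  -- the arrow σ : Spec ℚ(α) → Spec ℚ of D = FinSubextCat ℚ ℝ
  let Xα : FinSubextCat ℚ ℝ := ⟨ℚ⟮α⟯⟩
  let X₀ : FinSubextCat ℚ ℝ := ⟨⊥⟩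
  let σ : Xα ⟶ X₀ := ⟨IntermediateField.inclusion bot_le⟩
  -- σ is a monomorphism (rigidity) …
  have hmono : Mono σ := by
    refine ⟨fun {W} g₁ g₂ _ => FinSubextCat.hom_ext ?_⟩
    have key : (W.L.val).comp g₁.toAlgHom = (W.L.val).comp g₂.toAlgHom :=
      (adjoin.powerBasis hαint).algHom_ext (by
        rw [adjoin.powerBasis_gen, AlgHom.comp_apply, AlgHom.comp_apply, IntermediateField.coe_val]
        exact (hrig W.L g₁.toAlgHom).trans (hrig W.L g₂.toAlgHom).symm)
    exact AlgHom.ext fun z => Subtype.ext (by simpa using DFunLike.congr_fun key z)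
  -- … and fiberwise-surjective (composita), hence an FSM-morphism
  have hfs : IsFiberwiseSurjective σ := by
    intro W γ
    exact ⟨⟨W.L ⊔ ℚ⟮α⟯⟩, ⟨IntermediateField.inclusion le_sup_right⟩, ⟨IntermediateField.inclusion le_sup_left⟩,
      FinSubextCat.hom_ext (hbot _ _ _)⟩
  -- Def. 1.1 (ii) (b) for Φ at the FSM-morphism σ, granted by the (refuted) closure
  have hbij := (h Γ).isMonoidOn.bijective_of_isFSM σ ⟨hfs, hmono⟩
  have hmem : (Finsupp.single () 1 : Unit →₀ ℕ) ∈ Γ.Phi Xα := fun hle => (hfin hle).elim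
  obtain ⟨x, hx⟩ := hbij.2 (Multiplicative.ofAdd ⟨Finsupp.single () 1, hmem⟩)
  have hx1 : ((Multiplicative.toAdd x : Γ.Phi X₀) : Unit →₀ ℕ) () = 1 := by
    have h' := congrArg (fun z => ((Multiplicative.toAdd z : Γ.Phi Xα) : Unit →₀ ℕ) ()) hx
    change ((1 : ℕ) : ℕ) * ((Multiplicative.toAdd x : Γ.Phi X₀) : Unit →₀ ℕ) () =
      (Finsupp.single () 1 : Unit →₀ ℕ) () at h'
    rwa [one_mul, Finsupp.single_eq_same] at h'
  have heven : Even (((Multiplicative.toAdd x : Γ.Phi X₀) : Unit →₀ ℕ) ()) :=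
    (Multiplicative.toAdd x).2 (by rw [IntermediateField.finrank_bot])
  rw [hx1] at heven
  exact Nat.not_even_one heven

end Literature.AlgebraicGeometry.Frobenioids
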